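import Summits.ResolutionOfSingularities.ResolutionOfSingularities.Theorems.PurelyInseparableDim4WideNonTangent
import HarnessLib

/-!
# [OURS · res-dim4-pi] THE ORDER EXISTS AND THE TANGENT CONE IS NON-EMPTY — `o(F)` as a number, a
  non-zero homogeneous plane relation of degree exactly `o` modulo `J + 𝔪₀^{o+1}`, and the
  TANGENT-OR-DROP dichotomy at every move

Cell `res-dim4-pi` (D-0157 DOOR 2), seat `res-dim4-p-3` (g2); seventh file of the wide-core letter kit
(`…JetColength` · `…JetOrder` · `…JetOrderStaircase` · `…WidePlanar` · `…JetLevelTwo` · `…WideNonTangent`).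
idea-3's CARD I-3-11 §1 letters for a planar state (`𝔪₀ ≤ (x_a, x_b) + J + 𝔪₀²`): the ORDER
`o = max {k : d_k = k(k+1)/2}` and the TANGENT CONE `T` = the degree-`o` initial forms of the plane
relations.  Here, def-free: (1) the set `{k : d_k = k(k+1)/2}` is `{k ≤ o}` for a (unique) number `o`
whenever `d` is bounded (`exists_fatPointOrder`; downward staircase p663052 + plane bound p662591);
(2) at that `o` there is a NON-ZERO HOMOGENEOUS plane relation of degree exactly `o` in `J + 𝔪₀^{o+1}`
(`exists_homogeneous_relation`: a minimal relation is pure of degree `o`, its lower part being a relation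
at level `o`, killed by the order test); (3) with `…WideNonTangent` p665399: at every move from such a
state, EITHER the direction is a zero of that form (a TANGENT move — at most `o` points of the near
line), OR the laws (NT)(i)/(ii) fire (`exists_tangentForm_laws`).

[OURS · counted 0 · elementary linear algebra over the frame; AI kernel work, weaker than expert review.]
Nothing here is a statement about resolution of singularities; nothing here proves `NoWideTrap` /
`E2(3,3)`; resolution in dimension `≥ 4` / characteristic `p > 0` is NOT proved by anything in this file.
Host item (DR-157-C): `stmt-ResolutionOfSingularities-16155`, helper.
-/

noncomputable section

set_option linter.dupNamespace false -- mandated namespace of this single-conjunct summit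

open MvPolynomial Finset
open scoped BigOperators

namespace Summit.ResolutionOfSingularities.ResolutionOfSingularities.Theorems.PIDim4.RidgeBudget

open IsolationCert
open Literature.AlgebraicGeometry
open Literature.AlgebraicGeometry.Resolution
open Literature.AlgebraicGeometry.Resolution.Hauser2010
open Literature.AlgebraicGeometry.Resolution.HauserPerlega2019
open Literature.Barriers.ResolutionOfSingularities
open PointBlowup (direction gradSpan additiveSubspace boundarySubspace)

variable {K : Type} [Field K]

/-! ## §1 The order exists -/

/-- `k ≤ k(k+1)/2` for every `k`. OURS (arithmetic). [folklore] -/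
theorem le_triangle (k : ℕ) : k ≤ k * (k + 1) / 2 := by
  rcases Nat.eq_zero_or_pos k with rfl | hk
  · simp
  · exact (Nat.le_div_iff_mul_le two_pos).mpr (Nat.mul_le_mul_left k (by omega))

/-- **THE ORDER EXISTS.** For a planar `J` (`𝔪₀ ≤ (x_a, x_b) + J + 𝔪₀²`, `a ≠ b`) with bounded colength
sequence, the levels `k` with `d_k = k(k+1)/2` are exactly `{k ≤ o}` for some `o` — idea-3's fat-point
ORDER `o(F)` as a number (level `0` always qualifies; downward staircase; `k ≤ k(k+1)/2 ≤ B` bounds the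
set). OURS (linear algebra + `Nat.findGreatest`). [cite: AtiyahMacdonald1969, Prop. 6.9 (length is additive)] -/
theorem exists_fatPointOrder {J : Ideal (MvPolynomial (Fin 4) K)} {a b : Fin 4} (hab : a ≠ b)
    (hm : originIdeal K ≤ Ideal.span {(X a : MvPolynomial (Fin 4) K), X b} ⊔ J ⊔ originIdeal K ^ 2)
    {B : ℕ} (hbd : ∀ k, Module.finrank K (MvPolynomial (Fin 4) K ⧸ (J ⊔ originIdeal K ^ k)) ≤ B) :
    ∃ o, ∀ k, Module.finrank K (MvPolynomial (Fin 4) K ⧸ (J ⊔ originIdeal K ^ k)) = k * (k + 1) / 2 ↔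
      k ≤ o := by
  classical
  set P : ℕ → Prop := fun k =>
    Module.finrank K (MvPolynomial (Fin 4) K ⧸ (J ⊔ originIdeal K ^ k)) = k * (k + 1) / 2 with hP
  have hP0 : P 0 := by
    show Module.finrank K (MvPolynomial (Fin 4) K ⧸ (J ⊔ originIdeal K ^ 0)) = 0 * (0 + 1) / 2
    rw [finrank_quotient_sup_pow_zero]
  have hPB : ∀ k, P k → k ≤ B := fun k hk => by
    have h1 := hbd k
    have h2 := le_triangle k
    rw [hk] at h1
    exact h2.trans h1
  refine ⟨Nat.findGreatest P B, fun k => ⟨fun hk => Nat.le_findGreatest (hPB k hk) hk, fun hk => ?_⟩⟩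
  exact finrank_eq_triangle_downward hab hm (Nat.findGreatest_spec (P := P) (Nat.zero_le B) hP0) hk

/-! ## §2 A non-zero homogeneous relation of degree exactly `o` -/

/-- `K`-combinations of the `x_aⁱ x_bᵒ⁻ⁱ` are homogeneous of degree `o`. OURS (bookkeeping). [folklore] -/
theorem isHomogeneous_of_mem_span_pair_pow (a b : Fin 4) (o : ℕ) {g : MvPolynomial (Fin 4) K}
    (hg : g ∈ Submodule.span K (Set.range fun i : Fin (o + 1) =>
      (X a : MvPolynomial (Fin 4) K) ^ (i : ℕ) * X b ^ (o - (i : ℕ)))) :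
    g.IsHomogeneous o := by
  have hle : Submodule.span K (Set.range fun i : Fin (o + 1) =>
      (X a : MvPolynomial (Fin 4) K) ^ (i : ℕ) * X b ^ (o - (i : ℕ))) ≤
      (homogeneousSubmodule (Fin 4) K o).restrictScalars K := by
    refine Submodule.span_le.mpr ?_
    rintro _ ⟨i, rfl⟩
    show (X a : MvPolynomial (Fin 4) K) ^ (i : ℕ) * X b ^ (o - (i : ℕ)) ∈ homogeneousSubmodule (Fin 4) K o
    rw [mem_homogeneousSubmodule, X_pow_mul_X_pow_eq_monomial]
    refine isHomogeneous_monomial _ ?_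
    rw [map_add, Finsupp.degree_single, Finsupp.degree_single]
    have := Nat.lt_succ_iff.mp i.is_lt
    omega
  exact (mem_homogeneousSubmodule o g).mp (hle hg)

/-- The support of a homogeneous polynomial of degree `o` sits in degree `o`. OURS (bookkeeping). [folklore] -/
theorem degree_eq_of_isHomogeneous {g : MvPolynomial (Fin 4) K} {o : ℕ} (hg : g.IsHomogeneous o)
    {A : Fin 4 →₀ ℕ} (hA : A ∈ g.support) : A.degree = o := by
  rw [Finsupp.degree_eq_weight_one]
  exact hg (mem_support_iff.mp hA)

/-- **A NON-ZERO HOMOGENEOUS PLANE RELATION OF DEGREE EXACTLY `o`.** For planar `J` (`a ≠ b`): if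
`d_o = o(o+1)/2` but `d_{o+1} ≠ (o+1)(o+2)/2`, then some non-zero `K`-combination `g` of the
`x_aⁱ x_bᵒ⁻ⁱ` lies in `J + 𝔪₀^{o+1}` — the tangent cone `T(F)` of the fat point is non-empty.  (A minimal
relation at level `o + 1` is pure of degree `o`: its part of degree `< o` is a relation at level `o`,
which the order test kills.) OURS (linear algebra). [cite: AtiyahMacdonald1969, Prop. 6.9 (length is additive)] -/
theorem exists_homogeneous_relation {J : Ideal (MvPolynomial (Fin 4) K)} {a b : Fin 4} (hab : a ≠ b)
    (hm : originIdeal K ≤ Ideal.span {(X a : MvPolynomial (Fin 4) K), X b} ⊔ J ⊔ originIdeal K ^ 2)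
    {o : ℕ} (ho : Module.finrank K (MvPolynomial (Fin 4) K ⧸ (J ⊔ originIdeal K ^ o)) = o * (o + 1) / 2)
    (ho1 : Module.finrank K (MvPolynomial (Fin 4) K ⧸ (J ⊔ originIdeal K ^ (o + 1))) ≠
      (o + 1) * (o + 1 + 1) / 2) :
    ∃ g : MvPolynomial (Fin 4) K, g ≠ 0 ∧
      g ∈ Submodule.span K (Set.range fun i : Fin (o + 1) =>
        (X a : MvPolynomial (Fin 4) K) ^ (i : ℕ) * X b ^ (o - (i : ℕ))) ∧
      g ∈ J ⊔ originIdeal K ^ (o + 1) := by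
  classical
  rw [Ne, finrank_eq_triangle_iff hm (o + 1)] at ho1
  push Not at ho1
  obtain ⟨c, hcI, σ₀, hσ₀⟩ := ho1
  -- the relation `G` and its split into degree `< o` and degree `= o`
  set v : (Σ d : Fin (o + 1), Fin ((d : ℕ) + 1)) → MvPolynomial (Fin 4) K := fun σ =>
    (X a : MvPolynomial (Fin 4) K) ^ (σ.2 : ℕ) * X b ^ ((σ.1 : ℕ) - (σ.2 : ℕ)) with hv
  set G : MvPolynomial (Fin 4) K := ∑ σ, c σ • v σ with hG
  set Glow : MvPolynomial (Fin 4) K :=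
    ∑ σ ∈ Finset.univ.filter (fun σ => (σ.1 : ℕ) < o), c σ • v σ with hGlow
  set Gtop : MvPolynomial (Fin 4) K :=
    ∑ σ ∈ Finset.univ.filter (fun σ => ¬ (σ.1 : ℕ) < o), c σ • v σ with hGtop
  have hsplit : Glow + Gtop = G := Finset.sum_filter_add_sum_filter_not _ _ _
  have hG0 : G ≠ 0 := fun h0 =>
    hσ₀ (Fintype.linearIndependent_iff.mp (linearIndependent_sigma_pair_pow hab (o + 1)) c h0 σ₀)
  -- `Gtop` is a combination of the degree-`o` plane monomials, hence lies in `𝔪₀^o`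
  have hGtop_span : Gtop ∈ Submodule.span K (Set.range fun i : Fin (o + 1) =>
      (X a : MvPolynomial (Fin 4) K) ^ (i : ℕ) * X b ^ (o - (i : ℕ))) := by
    refine Submodule.sum_mem _ fun σ hσ => Submodule.smul_mem _ _ (Submodule.subset_span ?_)
    have hσo : (σ.1 : ℕ) = o := by
      have := (Finset.mem_filter.mp hσ).2
      have := σ.1.is_lt
      omega
    refine ⟨⟨σ.2, by have := σ.2.is_lt; omega⟩, ?_⟩
    show (X a : MvPolynomial (Fin 4) K) ^ ((σ.2 : ℕ)) * X b ^ (o - (σ.2 : ℕ)) =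
      (X a : MvPolynomial (Fin 4) K) ^ ((σ.2 : ℕ)) * X b ^ ((σ.1 : ℕ) - (σ.2 : ℕ))
    rw [show o - (σ.2 : ℕ) = (σ.1 : ℕ) - (σ.2 : ℕ) by omega]
  have hGtop_m : Gtop ∈ originIdeal K ^ o := by
    refine Ideal.sum_mem _ fun σ hσ => ?_
    have hσo : (σ.1 : ℕ) = o := by
      have := (Finset.mem_filter.mp hσ).2
      have := σ.1.is_lt
      omega
    have h : (X a : MvPolynomial (Fin 4) K) ^ (σ.2 : ℕ) * X b ^ ((σ.1 : ℕ) - (σ.2 : ℕ)) ∈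
        originIdeal K ^ (σ.1 : ℕ) :=
      X_pow_mul_X_pow_mem_originIdeal_pow a b (Nat.lt_succ_iff.mp σ.2.is_lt)
    rw [smul_eq_C_mul]
    exact Ideal.mul_mem_left _ _ (Ideal.pow_le_pow_right hσo.ge h)
  -- `Glow` is a degree-`< o` combination lying in `J + 𝔪₀^o`, hence `0` by the order test at `o`
  have hGlow_span : Glow ∈ Submodule.span K (Set.range fun τ : (Σ d : Fin o, Fin ((d : ℕ) + 1)) =>
      (X a : MvPolynomial (Fin 4) K) ^ (τ.2 : ℕ) * X b ^ ((τ.1 : ℕ) - (τ.2 : ℕ))) := by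
    refine Submodule.sum_mem _ fun σ hσ => Submodule.smul_mem _ _ (Submodule.subset_span ?_)
    exact ⟨⟨⟨σ.1, (Finset.mem_filter.mp hσ).2⟩, σ.2⟩, rfl⟩
  have hGlow_I : Glow ∈ J ⊔ originIdeal K ^ o := by
    have hG' : G ∈ J ⊔ originIdeal K ^ o :=
      sup_le_sup_left (Ideal.pow_le_pow_right (Nat.le_succ o)) J hcI
    have : Glow = G - Gtop := by rw [← hsplit]; ring
    rw [this]
    exact Submodule.sub_mem _ hG' (Submodule.mem_sup_right hGtop_m)
  have hGlow0 : Glow = 0 := by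
    have hdis := (finrank_eq_triangle_iff_disjoint hab hm o).mp ho
    rw [Submodule.disjoint_def] at hdis
    exact hdis _ hGlow_span ((Submodule.restrictScalars_mem K _ _).mpr hGlow_I)
  have hGeq : G = Gtop := by rw [← hsplit, hGlow0, zero_add]
  exact ⟨Gtop, hGeq ▸ hG0, hGtop_span, hGeq ▸ hcI⟩

/-! ## §3 Tangent-or-drop at every move -/

/-- **TANGENT OR DROP.** On a state of order `p` with `∇(in F) ≠ 0` and `ē ≤ 2`, planar in a pair
`(x_a, x_b)` with fat-point order data `d_o = o(o+1)/2`, `d_{o+1} ≠ (o+1)(o+2)/2`, `o ≥ 2`: there is a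
non-zero homogeneous plane relation `g` of degree `o` in `J_p⁺(F) + 𝔪₀^{o+1}` (a generator of the
tangent cone) such that at EVERY equimultiple move `(j, b)`: either the direction `e_j + b` is a zero of
`g` (a TANGENT move), or (NT) fires — `o(s⁺) ≤ o − 1` (`d_k(s⁺) < k(k+1)/2` for all `k ≥ o`) and, if
`o = 2`, `ē(s⁺) < ē(s)`. OURS (§2 ∘ `…WideNonTangent`). [cite: CossartJannsenSaito2020, Thm. 9.4] -/
theorem exists_tangentForm_laws [DecidableEq K] (p : ℕ) [Fact p.Prime] [CharP K p] {s : State K}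
    (hord : ordZero s.F = p) (hgrad : gradSpan (initialForm s.F) ≠ ⊥) (he : ebar s.F ≤ 2)
    {a b : Fin 4} (hab : a ≠ b)
    (hm : originIdeal K ≤ Ideal.span {(X a : MvPolynomial (Fin 4) K), X b} ⊔ singLocusIdeal p s.F ⊔
      originIdeal K ^ 2)
    {o : ℕ} (ho2 : 2 ≤ o) (ho : jetColength p o s.F = o * (o + 1) / 2)
    (ho1 : jetColength p (o + 1) s.F ≠ (o + 1) * (o + 1 + 1) / 2) :
    ∃ g : MvPolynomial (Fin 4) K, g ≠ 0 ∧ g.IsHomogeneous o ∧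
      g ∈ singLocusIdeal p s.F ⊔ originIdeal K ^ (o + 1) ∧
      ∀ (j : Fin 4) (c : Fin 4 → K), c j = 0 → CentreBlowup.IsEquimultiplePoint p Finset.univ j c s →
        eval (Function.update c j 1) g ≠ 0 →
          (∀ k, o ≤ k → jetColength p k (CentreBlowup.step p Finset.univ j c s).F < k * (k + 1) / 2) ∧
          (o = 2 → ebar (CentreBlowup.step p Finset.univ j c s).F < ebar s.F) := by
  obtain ⟨g, hg0, hgspan, hgI⟩ := exists_homogeneous_relation hab hm ho ho1
  have hhom : g.IsHomogeneous o := isHomogeneous_of_mem_span_pair_pow a b o hgspan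
  have hsupp : ∀ A ∈ g.support, o ≤ A.degree := fun A hA => (degree_eq_of_isHomogeneous hhom hA).ge
  have hcomp : homogeneousComponent o g = g := by
    rw [homogeneousComponent_of_mem ((mem_homogeneousSubmodule o g).mpr hhom), if_pos rfl]
  refine ⟨g, hg0, hhom, hgI, fun j c hcj heq hw => ⟨fun k hk => ?_, fun ho2' => ?_⟩⟩
  · exact jetColength_step_lt_triangle_of_eval_ne_zero p hord hgrad hcj heq he (by omega) le_rfl hgI
      hsupp (by rw [hcomp]; exact hw) hk
  · subst ho2'
    exact ebar_step_lt_of_eval_ne_zero p hord hgrad hcj heq le_rfl hgI hsupp (by rw [hcomp]; exact hw)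

end Summit.ResolutionOfSingularities.ResolutionOfSingularities.Theorems.PIDim4.RidgeBudget

end
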